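import Summits.AtomisticToContinuum.HydrodynamicLimit.Theorems.OneFlightGossipEngineKineticCurrentsWindowLDUniformLedgerAssembly
import Summits.AtomisticToContinuum.HydrodynamicLimit.Theorems.OneFlightGossipEngineKineticCurrentsWindowLDUniformCanonicalProxy
import Summits.AtomisticToContinuum.HydrodynamicLimit.Theorems.OneFlightGossipEngineKineticCurrentsWindowLDUniformForecastIncrement
import Summits.AtomisticToContinuum.HydrodynamicLimit.Theorems.OneFlightGossipEngineKineticCurrentsWindowLDUniformCanonicalSummable
import Literature.MathematicalPhysics.KineticTheory.VelocityBlindPlacement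

/-!
# Transfer for the crux `KineticCurrentsWindowLDUniform` (stmt-AtomisticToContinuum-14662), line
# `gossip-forecast-ledger`: the canonical form — `K2 ∧ K3c ⟹ crux`

The line's registered open stubs after the lead's reshape (chain c1, cycle 1) are K2 = `stub_forecastMoment`
(exponential moment of the initial forecast of a half's window functional) and K3c = `stub_qvMomentCanonical`
(exponential moment of the CANONICAL predictable quadratic-variation proxy
`V_k = (2/α²)·max(0, log λ[e^{α d_k} | ℱ k])` of the forecast martingale). Here we put the complete transfer in
the tree: `qvMoment_of_canonical : K3c → K3` (the canonical proxy is a valid proxy: landed S4a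
`stub_canonicalProxy`, S4b `stub_forecastIncrementExpIntegrable`, S4d `stub_qvCanonicalSummable`, S1
`stub_kickFiltration`) and the registered `stub_transfer_of_canonical_moments : K2 → K3c →
OneFlightGossipEngine.KineticCurrentsWindowLDUniform` (through the landed `stub_ledgerAssembly_of_moments`).
So any proof of the two dynamical statements K2, K3c closes the crux with a three-line file. Statements are
spelled over the tree abbreviations `VelocityBlindPlacement.Flow σ N` / `Phase N` (as in
`stub_ledgerAssembly_of_moments`) to keep the registered signature within the registry's length cap; they are
definitionally the skeleton's statements.

References: C. Kipnis, C. Landim, *Scaling Limits of Interacting Particle Systems* (1999), App. 1 §8;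
H. Spohn, *Large Scale Dynamics of Interacting Particles* (1991), Part I §2.3.
-/

noncomputable section

open MeasureTheory Set Filter InformationTheory
open scoped ENNReal Topology Classical ProbabilityTheory

namespace Summit.AtomisticToContinuum.HydrodynamicLimit.Theorems.KineticCurrentsWindowLDUniformGossip

open Literature.Analysis.FluidPDE (HardSphereFlow Config localMaxwellian collisionTimesOf nthTimeAfter)
open Literature.MathematicalPhysics.KineticTheory (T3 V3 hsDiameter localGibbsLaw)
open Summit.AtomisticToContinuum.HydrodynamicLimit.Theses.OneFlightGossipEngine (KineticCurrentsWindowLDUniform)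
open Literature.MathematicalPhysics.KineticTheory.VelocityBlindPlacement (Flow Phase)
open Literature.Analysis.FluidPDE.Torus (geometry)
open MeasurableSpace (comap)

/-- **K3c ⟹ K3.** The canonical predictable proxy of the forecast martingale is a valid proxy: from the
canonical moment bound K3c (`stub_qvMomentCanonical` of the skeleton, taken as a hypothesis) the `∃ V` form K3
(`stub_qvMoment` of the skeleton) follows by the landed abstract proxy lemma `stub_canonicalProxy`, the static
integrability `stub_forecastIncrementExpIntegrable`, the a.e. summability `stub_qvCanonicalSummable` and the
kick-filtration measurability `stub_kickFiltration`. [folklore] -/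
theorem qvMoment_of_canonical :
    (∃ η₀ : ℝ, 0 < η₀ ∧ η₀ ≤ 1 / 8 ∧ ∀ (a θ₀ : T3 → ℝ) (u₀ : T3 → V3), Continuous a → Continuous θ₀ → Continuous u₀ →
      (∀ x, 0 < a x) → (∀ x, 0 < θ₀ x) → ∀ σ : ℝ, 0 < σ → σ ^ 3 * (⨆ x, a x) ≤ η₀ * ∫ x, a x →
      ∀ Φ : (N : ℕ) → Flow σ N,
      ∀ (A : T3 → Fin 3 → Fin 3 → ℝ) (b : T3 → V3) (G : T3 × ℝ → ℝ),
      Continuous A → Continuous b → Continuous G →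
      ∀ (F : T3 × V3 → ℝ), (∀ y, F y =
        (∑ j : Fin 3, ∑ k : Fin 3, A y.1 j k * ((y.2 - u₀ y.1) j * (y.2 - u₀ y.1) k)) +
          (∑ j : Fin 3, b y.1 j * (y.2 - u₀ y.1) j) * G (y.1, ‖y.2 - u₀ y.1‖ ^ 2)) →
      ∀ C : ℝ, (∀ y, |F y| ≤ C * (1 + ‖y.2‖ ^ 2)) →
      (∀ x, ∫ v, F (x, v) * localMaxwellian 1 (θ₀ x) (u₀ x) v = 0) →
      (∀ x (j : Fin 3), ∫ v, F (x, v) * v j * localMaxwellian 1 (θ₀ x) (u₀ x) v = 0) →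
      (∀ x, ∫ v, F (x, v) * ‖v‖ ^ 2 * localMaxwellian 1 (θ₀ x) (u₀ x) v = 0) →
      ∃ α : ℝ, 0 < α ∧ α * (16 * max C 1 * ⨆ x, θ₀ x) ≤ 1 ∧ ∃ lam : ℝ, 0 < lam ∧ ∃ C₃ : ℝ,
      ∀ τ : ℝ, 0 < τ → ∀ δ : ℝ, 0 < δ → ∃ N₀ : ℕ, ∀ N : ℕ, N₀ ≤ N →
      ∀ S : Finset (Fin (N + 1)), 2 * S.card ≤ N + 2 →
      let μ : Measure (Phase N) := localGibbsLaw σ a u₀ θ₀ N (Φ N)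
      let X : Phase N → ℝ := fun z => ∑ i ∈ S, (τ * ((N : ℝ) + 1) ^ (-(1 / 3 : ℝ)))⁻¹ * ∫ r in (0 : ℝ)..(τ * ((N : ℝ) + 1) ^ (-(1 / 3 : ℝ))), F (((Φ N).flow r z) i)
      let T : Phase N → Set ℝ := fun z =>
        ⋃ i ∈ S, collisionTimesOf (geometry (Fin 3)) (hsDiameter σ N) (fun t => (Φ N).flow t z) i
      let tk : ℕ → Phase N → ℝ := fun k z => if z ∈ (Φ N).good then nthTimeAfter (T z) 0 k else 0
      let ℱ : ℕ → MeasurableSpace (Phase N) := fun n =>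
        comap (fun (z : Phase N) (i : S) => z i.1) inferInstance ⊔
          ⨆ k < n, comap (fun (z : Phase N) => (tk k z, fun i : S => (Φ N).flow (tk k z) z i.1))
            inferInstance
      let V : ℕ → Phase N → ℝ := fun k z =>
        2 / α ^ 2 * max 0 (Real.log ((μ[fun z => Real.exp (α * ((μ[X|ℱ (k + 1)]) z - (μ[X|ℱ k]) z))|ℱ k]) z))
      ∫⁻ z, ENNReal.ofReal (Real.exp (lam * ∑' k, V k z)) ∂μ ≤
        ENNReal.ofReal (Real.exp ((C₃ / τ + δ) * ((N : ℝ) + 1)))) →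
    (∃ η₀ : ℝ, 0 < η₀ ∧ ∀ (a θ₀ : T3 → ℝ) (u₀ : T3 → V3), Continuous a → Continuous θ₀ → Continuous u₀ →
      (∀ x, 0 < a x) → (∀ x, 0 < θ₀ x) → ∀ σ : ℝ, 0 < σ → σ ^ 3 * (⨆ x, a x) ≤ η₀ * ∫ x, a x →
      ∀ Φ : (N : ℕ) → Flow σ N,
      ∀ (A : T3 → Fin 3 → Fin 3 → ℝ) (b : T3 → V3) (G : T3 × ℝ → ℝ),
      Continuous A → Continuous b → Continuous G →
      ∀ (F : T3 × V3 → ℝ), (∀ y, F y =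
        (∑ j : Fin 3, ∑ k : Fin 3, A y.1 j k * ((y.2 - u₀ y.1) j * (y.2 - u₀ y.1) k)) +
          (∑ j : Fin 3, b y.1 j * (y.2 - u₀ y.1) j) * G (y.1, ‖y.2 - u₀ y.1‖ ^ 2)) →
      ∀ C : ℝ, (∀ y, |F y| ≤ C * (1 + ‖y.2‖ ^ 2)) →
      (∀ x, ∫ v, F (x, v) * localMaxwellian 1 (θ₀ x) (u₀ x) v = 0) →
      (∀ x (j : Fin 3), ∫ v, F (x, v) * v j * localMaxwellian 1 (θ₀ x) (u₀ x) v = 0) →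
      (∀ x, ∫ v, F (x, v) * ‖v‖ ^ 2 * localMaxwellian 1 (θ₀ x) (u₀ x) v = 0) →
      ∃ α : ℝ, 0 < α ∧ ∃ lam : ℝ, 0 < lam ∧ ∃ C₃ : ℝ, ∀ τ : ℝ, 0 < τ → ∀ δ : ℝ, 0 < δ → ∃ N₀ : ℕ, ∀ N : ℕ, N₀ ≤ N →
      ∀ S : Finset (Fin (N + 1)), 2 * S.card ≤ N + 2 →
      let μ : Measure (Phase N) := localGibbsLaw σ a u₀ θ₀ N (Φ N)
      let X : Phase N → ℝ := fun z => ∑ i ∈ S, (τ * ((N : ℝ) + 1) ^ (-(1 / 3 : ℝ)))⁻¹ * ∫ r in (0 : ℝ)..(τ * ((N : ℝ) + 1) ^ (-(1 / 3 : ℝ))), F (((Φ N).flow r z) i)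
      let T : Phase N → Set ℝ := fun z =>
        ⋃ i ∈ S, collisionTimesOf (geometry (Fin 3)) (hsDiameter σ N) (fun t => (Φ N).flow t z) i
      let tk : ℕ → Phase N → ℝ := fun k z => if z ∈ (Φ N).good then nthTimeAfter (T z) 0 k else 0
      let ℱ : ℕ → MeasurableSpace (Phase N) := fun n =>
        comap (fun (z : Phase N) (i : S) => z i.1) inferInstance ⊔
          ⨆ k < n, comap (fun (z : Phase N) => (tk k z, fun i : S => (Φ N).flow (tk k z) z i.1))
            inferInstance
      ∃ V : ℕ → Phase N → ℝ,
        (∀ k z, 0 ≤ V k z) ∧ (∀ k, Measurable[ℱ k] (V k)) ∧ (∀ᵐ z ∂μ, Summable (fun k => V k z)) ∧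
        (∀ (k : ℕ) (s : Set (Phase N)), MeasurableSet[ℱ k] s →
          ∫⁻ z in s, ENNReal.ofReal (Real.exp (α * ((μ[X|ℱ (k + 1)]) z - (μ[X|ℱ k]) z) - α ^ 2 * V k z / 2)) ∂μ
            ≤ μ s) ∧
        ∫⁻ z, ENNReal.ofReal (Real.exp (lam * ∑' k, V k z)) ∂μ ≤
          ENNReal.ofReal (Real.exp ((C₃ / τ + δ) * ((N : ℝ) + 1)))):= by
  -- K3 from its canonical form (S4c) through the LANDED abstract proxy lemma (S4a `…Gossip.stub_canonicalProxy`,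
  -- p107052), the LANDED static integrability (S4b `…Gossip.stub_forecastIncrementExpIntegrable`, p107149) and the
  -- LANDED kick-filtration measurability (S1 `…Gossip.stub_kickFiltration`, p101198); a.e. summability from the LANDED S4d `…Gossip.stub_qvCanonicalSummable` (p108597).
  intro hK3c
  obtain ⟨η₀, hη₀, hη8, H⟩ := hK3c
  refine ⟨η₀, hη₀, ?_⟩
  intro a θ₀ u₀ ha hθ hu ha0 hθ0 σ hσ hguard Φ A b G hA hb hG F hF C hC h1 hv h2
  obtain ⟨α, hα, hαle, lam, hlam, C₃, H⟩ :=
    H a θ₀ u₀ ha hθ hu ha0 hθ0 σ hσ hguard Φ A b G hA hb hG F hF C hC h1 hv h2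
  refine ⟨α, hα, lam, hlam, C₃, ?_⟩
  intro τ hτ δ hδ
  obtain ⟨N₀, H⟩ := H τ hτ δ hδ
  refine ⟨N₀, ?_⟩
  intro N hN S hS
  have hmom := H N hN S hS
  -- the activity guard with `η₀ ≤ 1/8` gives `σ ≤ 1/2`
  have hint_le : ∫ x, a x ≤ ⨆ x, a x :=
    Summit.AtomisticToContinuum.HydrodynamicLimit.Theorems.KineticCurrentsWindowLDUniformSketch.integral_le_iSup_T3 ha
  have hint_nn : 0 ≤ ∫ x, a x := integral_nonneg fun x => (ha0 x).le
  have hsup_pos : 0 < ⨆ x, a x :=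
    lt_of_lt_of_le (ha0 0) (le_ciSup (isCompact_range ha).bddAbove 0)
  have hσ2 : σ ≤ 1 / 2 := by
    have h8 : σ ^ 3 * (⨆ x, a x) ≤ 1 / 8 * (⨆ x, a x) :=
      hguard.trans ((mul_le_mul_of_nonneg_right hη8 hint_nn).trans
        (mul_le_mul_of_nonneg_left hint_le (by norm_num)))
    have h8' : σ ^ 3 ≤ (1 / 2) ^ 3 := by nlinarith
    exact le_of_pow_le_pow_left₀ (by norm_num) (by norm_num) h8'
  have hFc : Continuous F := by
    have hFeq : F = fun y : T3 × V3 =>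
        (∑ j : Fin 3, ∑ k : Fin 3, A y.1 j k * ((y.2 - u₀ y.1) j * (y.2 - u₀ y.1) k)) +
          (∑ j : Fin 3, b y.1 j * (y.2 - u₀ y.1) j) * G (y.1, ‖y.2 - u₀ y.1‖ ^ 2) := funext hF
    rw [hFeq]
    fun_prop
  haveI := Literature.MathematicalPhysics.KineticTheory.isProbabilityMeasure_localGibbsLaw ha hθ hu ha0 hθ0 hσ2 N (Φ N)
  have hle := (stub_kickFiltration
    σ hσ a θ₀ u₀ N (Φ N) F hFc τ hτ S).1
  have hexp := stub_forecastIncrementExpIntegrable a θ₀ u₀ ha hθ hu ha0 hθ0 σ hσ hσ2 N (Φ N) F hFc C hC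
    α hα hαle τ hτ S
  have hP := stub_canonicalProxy (Phase N) (localGibbsLaw σ a u₀ θ₀ N (Φ N)) _ hle _ α hα hexp
  have hsum := stub_qvCanonicalSummable a θ₀ u₀ ha hθ hu ha0 hθ0 σ hσ hσ2 N (Φ N) F hFc C hC α hα hαle τ hτ S
  exact ⟨_, hP.1, hP.2.1, hsum, hP.2.2, hmom⟩

/-- **Registered helper stub `stub_transfer_of_canonical_moments` — the transfer `K2 ∧ K3c ⟹ crux`.** The
forecast moment K2 (`stub_forecastMoment`) and the canonical QV moment K3c (`stub_qvMomentCanonical`) imply the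
crux `OneFlightGossipEngine.KineticCurrentsWindowLDUniform` (via `qvMoment_of_canonical` and the landed
`stub_ledgerAssembly_of_moments`). [folklore] -/
theorem stub_transfer_of_canonical_moments :
    (∃ η₀ : ℝ, 0 < η₀ ∧ ∀ (a θ₀ : T3 → ℝ) (u₀ : T3 → V3), Continuous a → Continuous θ₀ → Continuous u₀ →
      (∀ x, 0 < a x) → (∀ x, 0 < θ₀ x) → ∀ σ : ℝ, 0 < σ → σ ^ 3 * (⨆ x, a x) ≤ η₀ * ∫ x, a x →
      ∀ Φ : (N : ℕ) → Flow σ N,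
      ∀ (A : T3 → Fin 3 → Fin 3 → ℝ) (b : T3 → V3) (G : T3 × ℝ → ℝ),
      Continuous A → Continuous b → Continuous G →
      ∀ (F : T3 × V3 → ℝ), (∀ y, F y =
        (∑ j : Fin 3, ∑ k : Fin 3, A y.1 j k * ((y.2 - u₀ y.1) j * (y.2 - u₀ y.1) k)) +
          (∑ j : Fin 3, b y.1 j * (y.2 - u₀ y.1) j) * G (y.1, ‖y.2 - u₀ y.1‖ ^ 2)) →
      ∀ C : ℝ, (∀ y, |F y| ≤ C * (1 + ‖y.2‖ ^ 2)) →
      (∀ x, ∫ v, F (x, v) * localMaxwellian 1 (θ₀ x) (u₀ x) v = 0) →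
      (∀ x (j : Fin 3), ∫ v, F (x, v) * v j * localMaxwellian 1 (θ₀ x) (u₀ x) v = 0) →
      (∀ x, ∫ v, F (x, v) * ‖v‖ ^ 2 * localMaxwellian 1 (θ₀ x) (u₀ x) v = 0) →
      ∃ κ : ℝ, 0 < κ ∧ ∃ C₂ : ℝ, ∀ τ : ℝ, 0 < τ → ∀ δ : ℝ, 0 < δ → ∃ N₀ : ℕ, ∀ N : ℕ, N₀ ≤ N →
      ∀ S : Finset (Fin (N + 1)), 2 * S.card ≤ N + 2 →
      let μ : Measure (Phase N) := localGibbsLaw σ a u₀ θ₀ N (Φ N)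
      let X : Phase N → ℝ := fun z => ∑ i ∈ S, (τ * ((N : ℝ) + 1) ^ (-(1 / 3 : ℝ)))⁻¹ * ∫ r in (0 : ℝ)..(τ * ((N : ℝ) + 1) ^ (-(1 / 3 : ℝ))), F (((Φ N).flow r z) i)
      let T : Phase N → Set ℝ := fun z =>
        ⋃ i ∈ S, collisionTimesOf (geometry (Fin 3)) (hsDiameter σ N) (fun t => (Φ N).flow t z) i
      let tk : ℕ → Phase N → ℝ := fun k z => if z ∈ (Φ N).good then nthTimeAfter (T z) 0 k else 0
      let ℱ : ℕ → MeasurableSpace (Phase N) := fun n =>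
        comap (fun (z : Phase N) (i : S) => z i.1) inferInstance ⊔
          ⨆ k < n, comap (fun (z : Phase N) => (tk k z, fun i : S => (Φ N).flow (tk k z) z i.1))
            inferInstance
      ∫⁻ z, ENNReal.ofReal (Real.exp (κ * (μ[X|ℱ 0]) z)) ∂μ ≤
        ENNReal.ofReal (Real.exp ((C₂ / τ + δ) * ((N : ℝ) + 1)))) →
    (∃ η₀ : ℝ, 0 < η₀ ∧ η₀ ≤ 1 / 8 ∧ ∀ (a θ₀ : T3 → ℝ) (u₀ : T3 → V3), Continuous a → Continuous θ₀ → Continuous u₀ →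
      (∀ x, 0 < a x) → (∀ x, 0 < θ₀ x) → ∀ σ : ℝ, 0 < σ → σ ^ 3 * (⨆ x, a x) ≤ η₀ * ∫ x, a x →
      ∀ Φ : (N : ℕ) → Flow σ N,
      ∀ (A : T3 → Fin 3 → Fin 3 → ℝ) (b : T3 → V3) (G : T3 × ℝ → ℝ),
      Continuous A → Continuous b → Continuous G →
      ∀ (F : T3 × V3 → ℝ), (∀ y, F y =
        (∑ j : Fin 3, ∑ k : Fin 3, A y.1 j k * ((y.2 - u₀ y.1) j * (y.2 - u₀ y.1) k)) +
          (∑ j : Fin 3, b y.1 j * (y.2 - u₀ y.1) j) * G (y.1, ‖y.2 - u₀ y.1‖ ^ 2)) →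
      ∀ C : ℝ, (∀ y, |F y| ≤ C * (1 + ‖y.2‖ ^ 2)) →
      (∀ x, ∫ v, F (x, v) * localMaxwellian 1 (θ₀ x) (u₀ x) v = 0) →
      (∀ x (j : Fin 3), ∫ v, F (x, v) * v j * localMaxwellian 1 (θ₀ x) (u₀ x) v = 0) →
      (∀ x, ∫ v, F (x, v) * ‖v‖ ^ 2 * localMaxwellian 1 (θ₀ x) (u₀ x) v = 0) →
      ∃ α : ℝ, 0 < α ∧ α * (16 * max C 1 * ⨆ x, θ₀ x) ≤ 1 ∧ ∃ lam : ℝ, 0 < lam ∧ ∃ C₃ : ℝ,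
      ∀ τ : ℝ, 0 < τ → ∀ δ : ℝ, 0 < δ → ∃ N₀ : ℕ, ∀ N : ℕ, N₀ ≤ N →
      ∀ S : Finset (Fin (N + 1)), 2 * S.card ≤ N + 2 →
      let μ : Measure (Phase N) := localGibbsLaw σ a u₀ θ₀ N (Φ N)
      let X : Phase N → ℝ := fun z => ∑ i ∈ S, (τ * ((N : ℝ) + 1) ^ (-(1 / 3 : ℝ)))⁻¹ * ∫ r in (0 : ℝ)..(τ * ((N : ℝ) + 1) ^ (-(1 / 3 : ℝ))), F (((Φ N).flow r z) i)
      let T : Phase N → Set ℝ := fun z =>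
        ⋃ i ∈ S, collisionTimesOf (geometry (Fin 3)) (hsDiameter σ N) (fun t => (Φ N).flow t z) i
      let tk : ℕ → Phase N → ℝ := fun k z => if z ∈ (Φ N).good then nthTimeAfter (T z) 0 k else 0
      let ℱ : ℕ → MeasurableSpace (Phase N) := fun n =>
        comap (fun (z : Phase N) (i : S) => z i.1) inferInstance ⊔
          ⨆ k < n, comap (fun (z : Phase N) => (tk k z, fun i : S => (Φ N).flow (tk k z) z i.1))
            inferInstance
      let V : ℕ → Phase N → ℝ := fun k z =>
        2 / α ^ 2 * max 0 (Real.log ((μ[fun z => Real.exp (α * ((μ[X|ℱ (k + 1)]) z - (μ[X|ℱ k]) z))|ℱ k]) z))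
      ∫⁻ z, ENNReal.ofReal (Real.exp (lam * ∑' k, V k z)) ∂μ ≤
        ENNReal.ofReal (Real.exp ((C₃ / τ + δ) * ((N : ℝ) + 1)))) →
        KineticCurrentsWindowLDUniform :=
  fun h2 h3c => stub_ledgerAssembly_of_moments h2 (qvMoment_of_canonical h3c)

end Summit.AtomisticToContinuum.HydrodynamicLimit.Theorems.KineticCurrentsWindowLDUniformGossip

end
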